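import Mathlib
import Summits.KontsevichZagierPeriods.KontsevichZagierPeriods.Theorems.SoloInformedDivisionKernel
import Summits.KontsevichZagierPeriods.KontsevichZagierPeriods.Theorems.SoloInformedLiftMoves
import Literature.NumberTheory.Transcendental.EllIterRep
import Literature.NumberTheory.Transcendental.KZDominatedFamilyRelations
import Literature.NumberTheory.Transcendental.KZLogCalculusProofs
import HarnessLib
import HarnessLib.Audit

/-!
# Division by translation II: the translation move (solo-informed, s43)

Second file of LEMMA XXIX.1 KERNEL.  Notation of part I (`SoloInformedDivisionKernel`):
`0 < m < 1`, `κ(x) = (√(1−x²))⁻¹(√(1−m x²))⁻¹`, `T_a` Jacobi's addition map.  For real algebraic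
`m`, `a ∈ [0,1)` and `b ∈ (0,1)` satisfying the TURN CONDITION `b²(1 − m a²) ≤ 1 − a²`
(the translated arc `[v, v + u_b]`, `a = sn v`, `b = sn u_b`, stays inside the quarter period
`[0, K]`), the substitution `t ↦ T_a(t)` is ONE move of Kontsevich–Zagier's rule (2):

  `[(0,b), κ] ∼ [(a, T_a(b)), κ]`        (`soloInformed_addm_translation_move`),

since `T_a` is `ℚ`-semialgebraic (`soloInformed_addm_lift_sa`), strictly increasing on `[0,b]`
(`soloInformed_addm_strictMonoOn`), maps `(0,b)` onto `(a, T_a(b))` (`soloInformed_addm_image`)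
and `κ(T_a)·|T_a'| = κ` (part I).  Iterated along a division chain `s_{j+1} = T_{s_j}(s_1)`,
`s_q = 1`, these moves tile `[(0,1), κ] = K(m)` by `q` translates of `[(0,s_1), κ]` (part III).

References: C. G. J. Jacobi, *Fundamenta nova* (1829), §18; M. Kontsevich, D. Zagier, *Periods*
(2001), §1.2 rule (2); J. Bochnak, M. Coste, M.-F. Roy, *Real algebraic geometry* (1998), §2.2;
this work (solo-informed s43).
-/

noncomputable section

open MeasureTheory Set Filter
open scoped Classical

open Literature.NumberTheory.Transcendental Literature.NumberTheory.Transcendental.KZ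
open Literature.ModelTheory.ExponentialFields

namespace Summit.KontsevichZagierPeriods.KontsevichZagierPeriods.Theorems

/-! ### Semialgebraicity of the addition map -/

/-- The radicands `1 − x₀²`, `1 − m x₀²` and the denominator `1 − m a² x₀²` of the addition map are
`ℚ`-semialgebraic functions on every `ℚ`-semialgebraic `S ⊆ ℝ¹` (`m`, `a` algebraic).
[BCR 1998, §2.2] -/
theorem soloInformed_addm_pieces_sa {m a : ℝ} (hma : IsAlgebraic ℚ m) (haa : IsAlgebraic ℚ a)
    {S : Set (Fin 1 → ℝ)} (hS : IsSemialgebraic ℚ S) :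
    IsSemialgebraicFunOn ℚ S (fun x : Fin 1 → ℝ => 1 - x 0 ^ 2) ∧
    IsSemialgebraicFunOn ℚ S (fun x : Fin 1 → ℝ => 1 - m * x 0 ^ 2) ∧
    IsSemialgebraicFunOn ℚ S (fun x : Fin 1 → ℝ => 1 - m * a ^ 2 * x 0 ^ 2) := by
  refine ⟨?_, ?_, ?_⟩
  · refine ((isSemialgebraicFunOn_const_of_isAlgebraic hS isAlgebraic_one).sub_holds
      (isSemialgebraicFunOn_aeval hS (MvPolynomial.X 0 ^ 2))).congr fun x _ => ?_
    simp only [Pi.sub_apply, map_pow, MvPolynomial.aeval_X]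
  · refine ((isSemialgebraicFunOn_const_of_isAlgebraic hS isAlgebraic_one).sub_holds
      ((isSemialgebraicFunOn_const_of_isAlgebraic hS hma).mul_holds
        (isSemialgebraicFunOn_aeval hS (MvPolynomial.X 0 ^ 2)))).congr fun x _ => ?_
    simp only [Pi.sub_apply, Pi.mul_apply, map_pow, MvPolynomial.aeval_X]
  · refine ((isSemialgebraicFunOn_const_of_isAlgebraic hS isAlgebraic_one).sub_holds
      ((isSemialgebraicFunOn_const_of_isAlgebraic hS (hma.mul (haa.pow 2))).mul_holds
        (isSemialgebraicFunOn_aeval hS (MvPolynomial.X 0 ^ 2)))).congr fun x _ => ?_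
    simp only [Pi.sub_apply, Pi.mul_apply, map_pow, MvPolynomial.aeval_X]

/-- The constant `w(a) = √(1−a²)·√(1−m a²)` of the addition map is algebraic for algebraic
`m ∈ (0,1)`, `a ∈ [0,1]`. [folklore] -/
theorem soloInformed_addm_const_isAlgebraic {m a : ℝ} (hm : m ∈ Ioo (0:ℝ) 1)
    (hma : IsAlgebraic ℚ m) (ha : a ∈ Icc (0:ℝ) 1) (haa : IsAlgebraic ℚ a) :
    IsAlgebraic ℚ (√(1 - a ^ 2) * √(1 - m * a ^ 2)) := by
  obtain ⟨hA, hB⟩ := soloInformed_addm_radicands hm ha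
  have h1 : IsAlgebraic ℚ (√(1 - a ^ 2)) :=
    IsAlgebraic.of_pow two_pos (by rw [Real.sq_sqrt hA]; exact isAlgebraic_one.sub (haa.pow 2))
  have h2 : IsAlgebraic ℚ (√(1 - m * a ^ 2)) := IsAlgebraic.of_pow two_pos
    (by rw [Real.sq_sqrt hB.le]; exact isAlgebraic_one.sub (hma.mul (haa.pow 2)))
  exact h1.mul h2

/-- `T_a(b)` is algebraic for algebraic `m`, `a`, `b` (`a, b ∈ [0,1]`). [folklore] -/
theorem soloInformed_addm_isAlgebraic {m a b : ℝ} (hm : m ∈ Ioo (0:ℝ) 1)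
    (hma : IsAlgebraic ℚ m) (ha : a ∈ Icc (0:ℝ) 1) (haa : IsAlgebraic ℚ a)
    (hb : b ∈ Icc (0:ℝ) 1) (hba : IsAlgebraic ℚ b) :
    IsAlgebraic ℚ (soloInformedAddm m a b) :=
  ((hba.mul (soloInformed_addm_const_isAlgebraic hm hma ha haa)).add
    (haa.mul (soloInformed_addm_const_isAlgebraic hm hma hb hba))).mul
    (isAlgebraic_one.sub ((hma.mul (haa.pow 2)).mul (hba.pow 2))).inv

/-- **The lifted addition map `x ↦ (T_a(x₀))` is `ℚ`-semialgebraic** on every `ℚ`-semialgebraic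
`S ⊆ {0 ≤ x₀ ≤ 1}` (`m`, `a` algebraic): sums, products, square roots and a non-vanishing
quotient of semialgebraic functions. [BCR 1998, Prop. 2.2.6] -/
theorem soloInformed_addm_lift_sa {m a : ℝ} (hm : m ∈ Ioo (0:ℝ) 1) (hma : IsAlgebraic ℚ m)
    (ha : a ∈ Icc (0:ℝ) 1) (haa : IsAlgebraic ℚ a) {S : Set (Fin 1 → ℝ)}
    (hS : IsSemialgebraic ℚ S) (hS1 : ∀ x ∈ S, x 0 ∈ Icc (0:ℝ) 1) :
    IsSemialgebraicMapOn ℚ S (soloInformedLift (soloInformedAddm m a)) := by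
  obtain ⟨h1, h2, h3⟩ := soloInformed_addm_pieces_sa hma haa hS
  have hc := soloInformed_addm_const_isAlgebraic hm hma ha haa
  have hX : IsSemialgebraicFunOn ℚ S (fun x : Fin 1 → ℝ => x 0) :=
    (isSemialgebraicFunOn_aeval hS (MvPolynomial.X 0)).congr fun x _ => by
      simp only [MvPolynomial.aeval_X]
  refine IsSemialgebraicMapOn.of_forall hS fun j => ?_
  refine (((hX.mul_holds (isSemialgebraicFunOn_const_of_isAlgebraic hS hc)).add_holds
    ((isSemialgebraicFunOn_const_of_isAlgebraic hS haa).mul_holds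
      ((IsSemialgebraicFunOn.sqrt_holds h1).mul_holds (IsSemialgebraicFunOn.sqrt_holds h2)))).div
    h3 fun x hx => (soloInformed_addm_denom_pos hm ha (hS1 x hx)).ne').congr fun x _ => ?_
  simp only [Pi.add_apply, Pi.mul_apply, soloInformedLift, soloInformedAddm]

/-! ### Monotonicity and range on `[0, b]` under the turn condition -/

/-- Under the turn condition `b²(1 − m a²) ≤ 1 − a²`, every `t ∈ (0,b)` satisfies the STRICT sign
condition `t²(1 − m a²) < 1 − a²`. [this work] -/
theorem soloInformed_addm_strict_of_turn {m a b t : ℝ} (hm : m ∈ Ioo (0:ℝ) 1)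
    (ha : a ∈ Icc (0:ℝ) 1) (hturn : b ^ 2 * (1 - m * a ^ 2) ≤ 1 - a ^ 2) (ht : t ∈ Ioo (0:ℝ) b) :
    t ^ 2 * (1 - m * a ^ 2) < 1 - a ^ 2 := by
  have hB : 0 < 1 - m * a ^ 2 := (soloInformed_addm_radicands hm ha).2
  have ht2 : t ^ 2 < b ^ 2 := by nlinarith [ht.1, ht.2]
  exact (mul_lt_mul_of_pos_right ht2 hB).trans_le hturn

/-- `T_a` is continuous on `[0,1]`. [folklore] -/
theorem soloInformed_addm_continuousOn {m a : ℝ} (hm : m ∈ Ioo (0:ℝ) 1) (ha : a ∈ Icc (0:ℝ) 1) :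
    ContinuousOn (soloInformedAddm m a) (Icc (0:ℝ) 1) := by
  have e : soloInformedAddm m a = fun t => (t * (√(1 - a ^ 2) * √(1 - m * a ^ 2)) +
      a * (√(1 - t ^ 2) * √(1 - m * t ^ 2))) / (1 - m * a ^ 2 * t ^ 2) := rfl
  rw [e]
  have hN : Continuous fun t : ℝ => t * (√(1 - a ^ 2) * √(1 - m * a ^ 2)) +
      a * (√(1 - t ^ 2) * √(1 - m * t ^ 2)) := by fun_prop
  have hD : Continuous fun t : ℝ => 1 - m * a ^ 2 * t ^ 2 := by fun_prop
  exact hN.continuousOn.div hD.continuousOn fun t ht => (soloInformed_addm_denom_pos hm ha ht).ne'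

/-- **`T_a` is strictly increasing on `[0,b]`** under the turn condition (`T_a' > 0` inside).
[this work] -/
theorem soloInformed_addm_strictMonoOn {m a b : ℝ} (hm : m ∈ Ioo (0:ℝ) 1) (ha : a ∈ Icc (0:ℝ) 1)
    (hb : b ∈ Ioo (0:ℝ) 1) (hturn : b ^ 2 * (1 - m * a ^ 2) ≤ 1 - a ^ 2) :
    StrictMonoOn (soloInformedAddm m a) (Icc (0:ℝ) b) := by
  refine strictMonoOn_of_deriv_pos (convex_Icc 0 b)
    ((soloInformed_addm_continuousOn hm ha).mono (Icc_subset_Icc_right hb.2.le)) fun t ht => ?_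
  rw [interior_Icc] at ht
  have ht1 : t ∈ Ioo (0:ℝ) 1 := ⟨ht.1, ht.2.trans hb.2⟩
  rw [(soloInformed_addm_hasDerivAt hm ha ht1).deriv]
  exact soloInformed_addmDeriv_pos hm ha ht1 (soloInformed_addm_strict_of_turn hm ha hturn ht)

/-- Under the turn condition: `a < T_a(b) ≤ 1`. [this work] -/
theorem soloInformed_addm_endpoint {m a b : ℝ} (hm : m ∈ Ioo (0:ℝ) 1) (ha : a ∈ Icc (0:ℝ) 1)
    (hb : b ∈ Ioo (0:ℝ) 1) (hturn : b ^ 2 * (1 - m * a ^ 2) ≤ 1 - a ^ 2) :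
    a < soloInformedAddm m a b ∧ soloInformedAddm m a b ≤ 1 := by
  have h := soloInformed_addm_strictMonoOn hm ha hb hturn (left_mem_Icc.2 hb.1.le)
    (right_mem_Icc.2 hb.1.le) hb.1
  rw [soloInformed_addm_zero] at h
  exact ⟨h, (soloInformed_addm_lt_one hm ha ⟨hb.1.le, hb.2.le⟩).1⟩

/-- **`T_a` maps `(0,b)` onto `(a, T_a(b))`** under the turn condition (strict monotonicity and the
intermediate value theorem; `T_a(0) = a`). [this work] -/
theorem soloInformed_addm_image {m a b : ℝ} (hm : m ∈ Ioo (0:ℝ) 1) (ha : a ∈ Icc (0:ℝ) 1)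
    (hb : b ∈ Ioo (0:ℝ) 1) (hturn : b ^ 2 * (1 - m * a ^ 2) ≤ 1 - a ^ 2) :
    soloInformedAddm m a '' Ioo (0:ℝ) b = Ioo a (soloInformedAddm m a b) := by
  have hmono := soloInformed_addm_strictMonoOn hm ha hb hturn
  refine Subset.antisymm ?_ ?_
  · rintro _ ⟨t, ht, rfl⟩
    have h0 := hmono (left_mem_Icc.2 hb.1.le) ⟨ht.1.le, ht.2.le⟩ ht.1
    rw [soloInformed_addm_zero] at h0
    exact ⟨h0, hmono ⟨ht.1.le, ht.2.le⟩ (right_mem_Icc.2 hb.1.le) ht.2⟩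
  · have h := intermediate_value_Ioo hb.1.le
      ((soloInformed_addm_continuousOn hm ha).mono (Icc_subset_Icc_right hb.2.le))
    rwa [soloInformed_addm_zero] at h

/-! ### The translation move -/

/-- **LEMMA XXIX.1-K, the translation move (first kind).**  For real algebraic `0 < m < 1`,
`a ∈ [0,1)`, `b ∈ (0,1)` with `b²(1 − m a²) ≤ 1 − a²`, and any representations `r = [(0,b), κ]`,
`r' = [(a, T_a(b)), κ]` (`κ = ((1−t²)(1−m t²))^{-1/2}`): `[r] − [r'] ∈ relations` by ONE change
of variables `t ↦ T_a(t)` (rule 2) — `F(T_a(b)) − F(a) = F(b)`, i.e. `u ↦ u + v` in `P`.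
[this work] -/
theorem soloInformed_addm_translation_move {m a b : ℝ} (hm : m ∈ Ioo (0:ℝ) 1)
    (hma : IsAlgebraic ℚ m) (ha : a ∈ Icc (0:ℝ) 1) (haa : IsAlgebraic ℚ a) (hb : b ∈ Ioo (0:ℝ) 1)
    (hba : IsAlgebraic ℚ b) (hturn : b ^ 2 * (1 - m * a ^ 2) ≤ 1 - a ^ 2) (r r' : IntegralRep 1)
    (hrd : r.domain = {x | x 0 ∈ Ioo (0:ℝ) b})
    (hr'd : r'.domain = {x | x 0 ∈ Ioo a (soloInformedAddm m a b)})
    (hri : EqOn r.integrand (fun x => (√(1 - x 0 ^ 2))⁻¹ * (√(1 - m * x 0 ^ 2))⁻¹) r.domain)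
    (hr'i : EqOn r'.integrand (fun x => (√(1 - x 0 ^ 2))⁻¹ * (√(1 - m * x 0 ^ 2))⁻¹) r'.domain) :
    of r - of r' ∈ relations := by
  have himg := soloInformed_addm_image hm ha hb hturn
  refine changeOfVariablesRel_subset_relations (soloInformed_lift_mem_changeOfVariablesRel r r'
    (g := soloInformedAddm m a) (g' := soloInformedAddmDeriv m a) (S := Ioo (0:ℝ) b)
    (T := Ioo a (soloInformedAddm m a b)) hrd hr'd ?_ (fun t ht => ?_) ?_ himg fun x hx => ?_)
  · rw [hrd]
    exact soloInformed_addm_lift_sa hm hma ha haa ((isSemialgebraic_setOf_const_lt_apply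
      isAlgebraic_zero 0).inter (isSemialgebraic_setOf_apply_lt_const hba 0))
      fun x hx => ⟨le_of_lt hx.1, (le_of_lt hx.2).trans hb.2.le⟩
  · exact soloInformed_addm_hasDerivAt hm ha ⟨ht.1, ht.2.trans hb.2⟩
  · exact (soloInformed_addm_strictMonoOn hm ha hb hturn).injOn.mono Ioo_subset_Icc_self
  · have hxS : x 0 ∈ Ioo (0:ℝ) b := by rw [hrd] at hx; exact hx
    have hmem : soloInformedLift (soloInformedAddm m a) x ∈ r'.domain := by
      rw [hr'd, mem_setOf_eq, ← himg]
      exact ⟨x 0, hxS, rfl⟩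
    rw [hri hx, hr'i hmem]
    simp only [soloInformedLift]
    exact soloInformed_addm_jacobian hm ha ⟨hxS.1, hxS.2.trans hb.2⟩
      (soloInformed_addm_strict_of_turn hm ha hturn hxS)

end Summit.KontsevichZagierPeriods.KontsevichZagierPeriods.Theorems

end
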